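import Mathlib
import Summits.AtomisticToContinuum.HydrodynamicLimit.Theorems.InformationPercolationEngineKickFairRelEquilibriumMesoConditionThePastDefs
import HarnessLib

/-!
# Vocabulary of the line `kinetic-window-cut` for the crux `KickFairRelEquilibriumMeso`
(stmt-AtomisticToContinuum-15177; rank 2 of route `InformationPercolationEngine`) — strategist s1's ALT line, driven by lead c7

Definitions-only support file (`--supports stmt-AtomisticToContinuum-15177`): the objects of the checked skeleton
`Cruxes/KickFairRelEquilibriumMeso/Lines/kinetic_window_cut.lean` (strategist s1, 2026-08-17T10:57Z), copied byte-for-byte so that its stubs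
can land by name, plus the two Borel-measurability facts of the new pair events. It extends the vocabulary of the live line
`condition-the-past` (`…ConditionThePastDefs`, revs 1–2: `kickDev`, `betaLG`, `pairCondCovLG`, `SingleKickBias`, `CountExcessLG`, …).
Nothing is asserted: every `def … : Prop` is a predicate a stub proves or the glue consumes.

The mathematics: the fluctuation half of the crux re-cut by KINETIC WINDOWS of length `t_N` (strategist s1, `Lines/kinetic_window_cut.lean`): no cross-window pair is ever
formed (`E|Σ_w S_w| ≤ W^{1/2}(Σ_w E S_w²)^{1/2}`, the `N^{1/3}` windows paid by the kick weight), inside a window every pair is charged through the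
pair conditional covariance `pairCondCovLG` given the JOIN of the two pasts (the pull-out of `PairExpansion2`), CLOSE pairs (same window, colliding
spheres in close `rs N`-cells at their flight starts) are COUNTED (`ClosePairCount`, CP), FAR pairs charged `|Γ|` (`SameWindowPairCov`, SW). The objects
below are the strategist's, verbatim.
-/

noncomputable section

open MeasureTheory Set Filter Topology
open scoped ENNReal Classical

namespace Summit.AtomisticToContinuum.HydrodynamicLimit.Theorems.KickFairRelEquilibriumMesoLine

open Literature.Analysis.FluidPDE Literature.MathematicalPhysics.KineticTheory


/-- **Same kinetic window**: the two collision times (coordinate `.2.2.2` of the typed past) lie in the same window `[k·tw, (k+1)·tw)` of length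
`tw` (used with `tw = tN N = (N+1)^{-1/3}`). A Borel event of the pair of pasts (`measurableSet_sameWindow`). -/
def SameWindow {N : ℕ} (tw : ℝ) (p p' : Past N) : Prop :=
  ⌊p.2.2.2 / tw⌋ = ⌊p'.2.2.2 / tw⌋

/-- **Close cells** (mesh `r`): two integer cell vectors are close iff in every coordinate they differ by at most `1`, or by at least `1/r − 2`
(adjacent across the seam of the symmetric representative of `𝕋³`). Generous by design: `¬ CellClose` implies torus distance `≥ r` between the two
cells, which is all the window reduction uses. -/
def CellClose (r : ℝ) (k k' : Fin 3 → ℤ) : Prop :=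
  ∀ j : Fin 3, |((k j - k' j : ℤ) : ℝ)| ≤ 1 ∨ 1 / r - 2 ≤ |((k j - k' j : ℤ) : ℝ)|

/-- **Close pair** of kicks `(i,n)`, `(i',n')` with typed pasts `p`, `p'`: same kinetic window, and the cells of the two colliding spheres `i`, `i'`
at their own flight starts (first photo of each past, coordinate `.1.1.1`) are close. -/
def PairClose {N : ℕ} (r tw : ℝ) (p p' : Past N) (i i' : Fin (N + 1)) : Prop :=
  SameWindow tw p p' ∧ CellClose r (p.1.1.1 i).1 (p'.1.1.1 i').1

/-- **Far pair**: same kinetic window, cells of the two colliding spheres at their flight starts NOT close (mesoscopic separation `≥ r`, much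
larger than one flight `≍ t_N v̄` along any admissible sequence). -/
def PairFar {N : ℕ} (r tw : ℝ) (p p' : Past N) (i i' : Fin (N + 1)) : Prop :=
  SameWindow tw p p' ∧ ¬ CellClose r (p.1.1.1 i).1 (p'.1.1.1 i').1

/-- **SW — SAME-WINDOW, CELL-FAR PAIR CONDITIONAL COVARIANCE (`N^{1/3}`-normalised pair-Campbell-`L¹`).** Along `rs`: for continuous positive
profiles `∃ σ₀ ∀ σ < σ₀ ∀ Φ τ g δ ∃ N₀ ∀ N ≥ N₀`, `E_LG[(N+1)^{1/3} (ε/(N+1))² Σ_{(i,n)} Σ_{(i',n')} 1_{PairFar} |Γ((i,n),(i',n'))|] ≤ δ`,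
`Γ = pairCondCovLG`. At constant profiles: Gibbs regional factorisation + one-window light cone + `≤ 4`-photo statics; off equilibrium: equal-time
mesoscopic spatial decorrelation of `LG`-centred kicks under the evolved law. -/
def SameWindowPairCov (rs : ℕ → ℝ) : Prop :=
  ∀ (a₀ θ₀ : T3 → ℝ) (u₀ : T3 → V3), Continuous a₀ → Continuous θ₀ → Continuous u₀ →
    (∀ x, 0 < a₀ x) → (∀ x, 0 < θ₀ x) → ∃ σ₀ : ℝ, 0 < σ₀ ∧ ∀ σ : ℝ, 0 < σ → σ < σ₀ →
    ∀ Φ : (N : ℕ) → Flow σ N, ∀ τ : ℝ, 0 < τ →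
    ∀ g : V3 × V3 × V3 → ℝ, Continuous g → (∃ C : ℝ, ∀ p, |g p| ≤ C) →
    ∀ δ : ℝ, 0 < δ → ∃ N₀ : ℕ, ∀ N : ℕ, N₀ ≤ N →
    ∫⁻ z, ENNReal.ofReal (((N : ℝ) + 1) ^ (1 / 3 : ℝ) * (hsDiameter σ N / ((N : ℝ) + 1)) ^ 2 *
        ∑ i : Fin (N + 1), ∑ n ∈ Finset.range (cnt (Φ N) τ z i),
          ∑ i' : Fin (N + 1), ∑ n' ∈ Finset.range (cnt (Φ N) τ z i'),
            (if PairFar (rs N) (tN N) (past (Φ N) (rs N) z i n) (past (Φ N) (rs N) z i' n') i i'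
              then (1 : ℝ) else 0) *
              |pairCondCovLG σ a₀ θ₀ u₀ (Φ N) (rs N) g i n i' n' z|)
        ∂(localGibbsLaw σ a₀ u₀ θ₀ N (Φ N)) ≤ ENNReal.ofReal δ

/-- **CP — CLOSE SAME-WINDOW PAIR COUNT (`N^{1/3}`-normalised, `LG`-mean).** Along `rs`: for continuous positive profiles
`∃ σ₀ ∀ σ < σ₀ ∀ Φ τ δ ∃ N₀ ∀ N ≥ N₀`, `E_LG[(N+1)^{1/3} (ε/(N+1))² #{((i,n),(i',n')) : PairClose}] ≤ δ` (expected size `N^{-3/4}` for `rs N = (N+1)^{-1/4}`: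
a local second-moment count — no mesoscopic cell hosts a positive fraction of a window's kicks in `LG`-mean). -/
def ClosePairCount (rs : ℕ → ℝ) : Prop :=
  ∀ (a₀ θ₀ : T3 → ℝ) (u₀ : T3 → V3), Continuous a₀ → Continuous θ₀ → Continuous u₀ →
    (∀ x, 0 < a₀ x) → (∀ x, 0 < θ₀ x) → ∃ σ₀ : ℝ, 0 < σ₀ ∧ ∀ σ : ℝ, 0 < σ → σ < σ₀ →
    ∀ Φ : (N : ℕ) → Flow σ N, ∀ τ : ℝ, 0 < τ →
    ∀ δ : ℝ, 0 < δ → ∃ N₀ : ℕ, ∀ N : ℕ, N₀ ≤ N →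
    ∫⁻ z, ENNReal.ofReal (((N : ℝ) + 1) ^ (1 / 3 : ℝ) * (hsDiameter σ N / ((N : ℝ) + 1)) ^ 2 *
        ∑ i : Fin (N + 1), ∑ n ∈ Finset.range (cnt (Φ N) τ z i),
          ∑ i' : Fin (N + 1), ∑ n' ∈ Finset.range (cnt (Φ N) τ z i'),
            (if PairClose (rs N) (tN N) (past (Φ N) (rs N) z i n) (past (Φ N) (rs N) z i' n') i i'
              then (1 : ℝ) else 0))
        ∂(localGibbsLaw σ a₀ u₀ θ₀ N (Φ N)) ≤ ENNReal.ofReal δ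

/-- **`SameWindow` is a Borel event of the pair of typed pasts** (equality of two integer-valued Borel functions; registered sub-goal
`measurableSet_sameWindow`). [folklore] -/
theorem measurableSet_sameWindow : ∀ (N : ℕ) (tw : ℝ), MeasurableSet {q : Past N × Past N | SameWindow tw q.1 q.2} := by
  intro N tw
  have h1 : Measurable fun q : Past N × Past N => ⌊q.1.2.2.2 / tw⌋ :=
    Int.measurable_floor.comp
      ((measurable_snd.comp (measurable_snd.comp (measurable_snd.comp measurable_fst))).div_const tw)
  have h2 : Measurable fun q : Past N × Past N => ⌊q.2.2.2.2 / tw⌋ :=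
    Int.measurable_floor.comp
      ((measurable_snd.comp (measurable_snd.comp (measurable_snd.comp measurable_snd))).div_const tw)
  exact measurableSet_eq_fun h1 h2

/-- **`CellClose` of the first-photo cells of two given spheres is a Borel event of the pair of typed pasts** (the cell coordinates are
`ℤ`-valued, hence every predicate of them is measurable once the coordinate maps are; registered sub-goal `measurableSet_cellClose`). [folklore] -/
theorem measurableSet_cellClose : ∀ (N : ℕ) (r : ℝ) (i i' : Fin (N + 1)),
    MeasurableSet {q : Past N × Past N | CellClose r (q.1.1.1.1 i).1 (q.2.1.1.1 i').1} := by
  intro N r i i'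
  -- the pair of cell vectors is a measurable map into a countable discrete space
  have hk : Measurable fun q : Past N × Past N => ((q.1.1.1.1 i).1, (q.2.1.1.1 i').1) := by
    refine Measurable.prodMk ?_ ?_
    · exact measurable_fst.comp ((measurable_pi_apply i).comp
        (measurable_fst.comp (measurable_fst.comp (measurable_fst.comp measurable_fst))))
    · exact measurable_fst.comp ((measurable_pi_apply i').comp
        (measurable_fst.comp (measurable_fst.comp (measurable_fst.comp measurable_snd))))
  have : {q : Past N × Past N | CellClose r (q.1.1.1.1 i).1 (q.2.1.1.1 i').1} =
      (fun q : Past N × Past N => ((q.1.1.1.1 i).1, (q.2.1.1.1 i').1)) ⁻¹' {kk | CellClose r kk.1 kk.2} := rfl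
  rw [this]
  exact hk (MeasurableSet.of_discrete)

end Summit.AtomisticToContinuum.HydrodynamicLimit.Theorems.KickFairRelEquilibriumMesoLine

end
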